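import Summits.HodgeConjecture.CorCM.Census.DicyclicTwistResidual

/-!
# The dicyclic twist `Dic(A) ⊃ ℤ/2 × A`, VI: the key lemma — a normal residual Hodge vector is determined by its `2|A| + 2` functionals

COR-CM (cell `pub-hodgecm2`, stage 2 of the Hodge ladder), count-neutral KERNEL COMBINATORICS by the binder seat b23 (gen 42; claim
DICYCLIC-COLUMN, HOME/INBOX.md l.10328): part VI of the lane `DicyclicTwist*`.  Bookkeeping definition with body (`NFset`) + theorems on top of
parts I–V; no `decide` table, no certificate, no named fact, no geometry, no `sorry`.  `Interfaces.lean` (C1), every E term, B01,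
`Transposition/*`, `PortJoin/*` untouched.
HONEST FRAMING: `HC_CM` is NOT proved, here or anywhere in the tree; nothing here is a period, a count of record or a headline.

CONTENT (`|A|` odd, `≥ 3`; dictionary of parts I–V).  A vector `r` supported on the normal residual labels (potential `≤ 1`, `ψ₀` low; part V:
the six shapes `(0,0), (0,1), (0,δ t), (0,1+δ t), (δ s,0), (δ s,1)`, collected in the finset `NFset`, §1) has coefficients
`x₀, x₁, p_t, q_t, y_s, z_s`; every sum over its support splits along the six shapes (`sum_eq_of_normal`).  §2 reads the data of `r`:
the Pohlmann forms of `(0,t)` on the two marginals (`form₁_eq`, `form₀_eq`: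
`x₀ − x₁ + P − Q + Y − Z − 2 p_t + 2 q_t` and `x₀ + x₁ + P + Q + Y + Z − 2 (y_t + z_t)`), `C₁ r = P − Q`, `C₀ r = Y + Z` (and, part V,
`U_s r = q_s`, `U'_s r = −z_s`).  §3 THE KEY LEMMA **`eq_zero_of_normal`**: if `r` is Hodge and `U_s r = U'_s r = 0` for all `s` and
`C₀ r = C₁ r = 0`, then `r = 0`; and **`card_dvd_C₁`**, **`card_dvd_C₀`**: on a normal residual Hodge vector `C₁`, `C₀` are multiples of
`|A|` (the differences `p_t − q_t`, the sums `y_s + z_s` are constant).  Part VII combines this with the descent (part III), the vanishing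
(part IV) and two equator-crossing squares.  All [folklore].

## References
* [Pohlmann1968] H. Pohlmann, Algebraic cycles on abelian varieties of complex multiplication type, Ann. of Math. 88 (1968), Thm 1.
-/

namespace Summit.HodgeConjecture.CorCM.Census.DicyclicTwist

open Finset
open Summit.HodgeConjecture.CorCM.Census.OddSliceFacesModel
open Summit.HodgeConjecture.CorCM.Census.OddSliceFacesSquares
open Summit.HodgeConjecture.CorCM.Census.OddSliceFacesDescent
open Summit.HodgeConjecture.CorCM.Census.EvenSliceFacesDescent
open Summit.HodgeConjecture.CorCM.Census.OddSliceFacesGenerate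

variable (A : Type) [AddCommGroup A] [Fintype A] [DecidableEq A]

/-! ## §1 The finset of normal residual labels and sums over it -/

/-- The six families of normal residual labels. [folklore] -/
def NFset : Finset (Ty₂ A) :=
  ((({((0 : Ty A), (0 : Ty A)), ((0 : Ty A), (1 : Ty A))} ∪ univ.image fun t : A => ((0 : Ty A), δ A t)) ∪
    univ.image fun t : A => ((0 : Ty A), 1 + δ A t)) ∪ univ.image fun s : A => (δ A s, (0 : Ty A))) ∪
    univ.image fun s : A => (δ A s, (1 : Ty A))

omit [AddCommGroup A] in
/-- A normal residual label lies in `NFset`. [folklore] -/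
theorem mem_NFset {Ψ : Ty₂ A} (hp : pot A Ψ ≤ 1) (hl : (wt A Ψ.1 ≤ Fintype.card A / 2)) : Ψ ∈ NFset A := by
  obtain ⟨a, b⟩ := Ψ
  unfold NFset
  simp only [Finset.mem_union, Finset.mem_insert, Finset.mem_singleton, Finset.mem_image, Finset.mem_univ, true_and, Prod.mk.injEq]
  rcases normal_cases A hp hl with ⟨ha, hb⟩ | ⟨s, ha, hb⟩ <;> simp only at ha hb
  · subst ha
    rcases hb with rfl | rfl | ⟨t, rfl | rfl⟩
    · exact Or.inl (Or.inl (Or.inl (Or.inl (Or.inl ⟨rfl, rfl⟩))))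
    · exact Or.inl (Or.inl (Or.inl (Or.inl (Or.inr ⟨rfl, rfl⟩))))
    · exact Or.inl (Or.inl (Or.inl (Or.inr ⟨t, rfl, rfl⟩)))
    · exact Or.inl (Or.inl (Or.inr ⟨t, rfl, rfl⟩))
  · subst ha
    rcases hb with rfl | rfl
    · exact Or.inl (Or.inr ⟨s, rfl, rfl⟩)
    · exact Or.inr ⟨s, rfl, rfl⟩

omit [AddCommGroup A] [Fintype A] [DecidableEq A] in
/-- `(0 : Ty A) ≠ 1`. [folklore] -/
theorem zero_ne_one_ty [Nonempty A] : (0 : Ty A) ≠ 1 := by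
  intro h
  have := congrFun h (Classical.arbitrary A)
  exact zero_ne_one this

omit [AddCommGroup A] in
/-- `δ t ≠ 1` (`|A| ≥ 2`). [folklore] -/
theorem delta_ne_one (h2 : 2 ≤ Fintype.card A) (t : A) : δ A t ≠ (1 : Ty A) := fun h =>
  not_isLow_one A (by omega) (h ▸ isLow_delta A h2 t)

omit [AddCommGroup A] in
/-- `1 + δ t ≠ 0` (`|A| ≥ 3`). [folklore] -/
theorem one_add_delta_ne_zero (h3 : 3 ≤ Fintype.card A) (t : A) : (1 : Ty A) + δ A t ≠ 0 := fun h =>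
  not_isLow_one_add_delta A h3 t (h.symm ▸ isLow_zero A)

omit [AddCommGroup A] [Fintype A] in
/-- `1 + δ t ≠ 1`. [folklore] -/
theorem one_add_delta_ne_one (t : A) : (1 : Ty A) + δ A t ≠ 1 := fun h => by
  have h' : (1 : Ty A) + δ A t = 1 + 0 := by rw [add_zero]; exact h
  exact delta_ne_zero A t (add_left_cancel h')

omit [AddCommGroup A] in
/-- `δ t ≠ 1 + δ t'` (`|A| ≥ 3`). [folklore] -/
theorem delta_ne_one_add_delta (h3 : 3 ≤ Fintype.card A) (t t' : A) : δ A t ≠ 1 + δ A t' := fun h =>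
  not_isLow_one_add_delta A h3 t' (h ▸ isLow_delta A (by omega) t)

omit [AddCommGroup A] in
/-- **Sums over the normal residual labels split along the six shapes** (`|A| ≥ 3`). [folklore] -/
theorem sum_NFset (h3 : 3 ≤ Fintype.card A) (g : Ty₂ A → ℤ) :
    ∑ Ψ ∈ NFset A, g Ψ = g (0, 0) + g (0, 1) + ∑ t : A, g (0, δ A t) + ∑ t : A, g (0, 1 + δ A t) +
      ∑ s : A, g (δ A s, 0) + ∑ s : A, g (δ A s, 1) := by
  haveI : Nonempty A := Fintype.card_pos_iff.mp (by omega)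
  have h2 : 2 ≤ Fintype.card A := by omega
  have i1 : Function.Injective fun t : A => ((0 : Ty A), δ A t) := fun t t' h => delta_inj A (Prod.mk.inj h).2
  have i2 : Function.Injective fun t : A => ((0 : Ty A), 1 + δ A t) :=
    fun t t' h => delta_inj A (add_left_cancel (Prod.mk.inj h).2)
  have i3 : Function.Injective fun s : A => (δ A s, (0 : Ty A)) := fun s s' h => delta_inj A (Prod.mk.inj h).1
  have i4 : Function.Injective fun s : A => (δ A s, (1 : Ty A)) := fun s s' h => delta_inj A (Prod.mk.inj h).1
  unfold NFset
  rw [Finset.sum_union, Finset.sum_union, Finset.sum_union, Finset.sum_union, Finset.sum_pair,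
    Finset.sum_image fun t _ t' _ h => i1 h, Finset.sum_image fun t _ t' _ h => i2 h,
    Finset.sum_image fun s _ s' _ h => i3 h, Finset.sum_image fun s _ s' _ h => i4 h]
  -- the disjointness side goals, innermost first
  · intro h; exact zero_ne_one_ty A (Prod.mk.inj h).2
  · rw [Finset.disjoint_left]
    intro Ψ hΨ hΨ'
    simp only [Finset.mem_insert, Finset.mem_singleton, Finset.mem_image, Finset.mem_univ, true_and] at hΨ hΨ'
    obtain ⟨t, rfl⟩ := hΨ'
    rcases hΨ with h | h
    · exact delta_ne_zero A t (Prod.mk.inj h).2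
    · exact delta_ne_one A h2 t (Prod.mk.inj h).2
  · rw [Finset.disjoint_left]
    intro Ψ hΨ hΨ'
    simp only [Finset.mem_union, Finset.mem_insert, Finset.mem_singleton, Finset.mem_image, Finset.mem_univ, true_and] at hΨ hΨ'
    obtain ⟨t, rfl⟩ := hΨ'
    rcases hΨ with (h | h) | ⟨t', h⟩
    · exact one_add_delta_ne_zero A h3 t (Prod.mk.inj h).2
    · exact one_add_delta_ne_one A t (Prod.mk.inj h).2
    · exact delta_ne_one_add_delta A h3 t' t (Prod.mk.inj h).2
  · rw [Finset.disjoint_left]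
    intro Ψ hΨ hΨ'
    simp only [Finset.mem_union, Finset.mem_insert, Finset.mem_singleton, Finset.mem_image, Finset.mem_univ, true_and] at hΨ hΨ'
    obtain ⟨s, rfl⟩ := hΨ'
    rcases hΨ with ((h | h) | ⟨t, h⟩) | ⟨t, h⟩
    · exact delta_ne_zero A s (Prod.mk.inj h).1
    · exact delta_ne_zero A s (Prod.mk.inj h).1
    · exact delta_ne_zero A s (Prod.mk.inj h).1.symm
    · exact delta_ne_zero A s (Prod.mk.inj h).1.symm
  · rw [Finset.disjoint_left]
    intro Ψ hΨ hΨ'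
    simp only [Finset.mem_union, Finset.mem_insert, Finset.mem_singleton, Finset.mem_image, Finset.mem_univ, true_and] at hΨ hΨ'
    obtain ⟨s, rfl⟩ := hΨ'
    rcases hΨ with (((h | h) | ⟨t, h⟩) | ⟨t, h⟩) | ⟨s', h⟩
    · exact delta_ne_zero A s (Prod.mk.inj h).1
    · exact delta_ne_zero A s (Prod.mk.inj h).1
    · exact delta_ne_zero A s (Prod.mk.inj h).1.symm
    · exact delta_ne_zero A s (Prod.mk.inj h).1.symm
    · exact zero_ne_one_ty A (Prod.mk.inj h).2

omit [AddCommGroup A] in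
/-- **A sum of a function supported on the normal residual labels splits along the six shapes.** [folklore] -/
theorem sum_eq_of_normal (h3 : 3 ≤ Fintype.card A) (g : Ty₂ A → ℤ) (hg : ∀ Ψ, g Ψ ≠ 0 → pot A Ψ ≤ 1 ∧ (wt A Ψ.1 ≤ Fintype.card A / 2)) :
    ∑ Ψ : Ty₂ A, g Ψ = g (0, 0) + g (0, 1) + ∑ t : A, g (0, δ A t) + ∑ t : A, g (0, 1 + δ A t) +
      ∑ s : A, g (δ A s, 0) + ∑ s : A, g (δ A s, 1) := by
  rw [← sum_NFset A h3 g]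
  symm
  refine Finset.sum_subset (Finset.subset_univ _) fun Ψ _ hΨ => ?_
  by_contra hne
  exact hΨ (mem_NFset A (hg Ψ hne).1 (hg Ψ hne).2)

/-! ## §2 The data of a normal residual vector: forms and class functionals -/

omit [AddCommGroup A] in
/-- The Pohlmann form of `g` on the `1`-marginal as a sum over labels. [folklore] -/
theorem coef_dotProduct_marg₁ (g : ZMod 2 × A) (v : Ty₂ A → ℤ) :
    coef A g ⬝ᵥ marg₁ A v = ∑ Ψ : Ty₂ A, coef A g Ψ.2 * v Ψ := by
  rw [Fintype.sum_prod_type, Finset.sum_comm]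
  unfold dotProduct
  refine Finset.sum_congr rfl fun b _ => ?_
  rw [marg₁_apply, Finset.mul_sum]

omit [AddCommGroup A] in
/-- The Pohlmann form of `g` on the `0`-marginal as a sum over labels. [folklore] -/
theorem coef_dotProduct_marg₀ (g : ZMod 2 × A) (v : Ty₂ A → ℤ) :
    coef A g ⬝ᵥ marg₀ A v = ∑ Ψ : Ty₂ A, coef A g Ψ.1 * v Ψ := by
  rw [Fintype.sum_prod_type]
  unfold dotProduct
  refine Finset.sum_congr rfl fun a _ => ?_
  rw [marg₀_apply, Finset.mul_sum]

omit [AddCommGroup A] in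
/-- `C₁` as a sum over labels. [folklore] -/
theorem C₁_eq_sum (v : Ty₂ A → ℤ) : C₁ A v = ∑ Ψ : Ty₂ A, cwt A Ψ.2 * v Ψ := by
  rw [C₁_apply]
  show cwt A ⬝ᵥ marg₁ A v = _
  rw [Fintype.sum_prod_type, Finset.sum_comm]
  unfold dotProduct
  refine Finset.sum_congr rfl fun b _ => ?_
  rw [marg₁_apply, Finset.mul_sum]

omit [AddCommGroup A] in
/-- `C₀` as a sum over labels. [folklore] -/
theorem C₀_eq_sum (v : Ty₂ A → ℤ) : C₀ A v = ∑ Ψ : Ty₂ A, cwt A Ψ.1 * v Ψ := by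
  rw [C₀_apply]
  show cwt A ⬝ᵥ marg₀ A v = _
  rw [Fintype.sum_prod_type]
  unfold dotProduct
  refine Finset.sum_congr rfl fun a _ => ?_
  rw [marg₀_apply, Finset.mul_sum]

omit [AddCommGroup A] [Fintype A] [DecidableEq A] in
/-- `coef (0,t) 0 = 1`. [folklore] -/
theorem coef_zero_zero (t : A) : coef A (0, t) (0 : Ty A) = 1 := by simp [coef]

omit [AddCommGroup A] [Fintype A] [DecidableEq A] in
/-- `coef (0,t) 1 = −1`. [folklore] -/
theorem coef_zero_one (t : A) : coef A (0, t) (1 : Ty A) = -1 := by simp [coef]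

omit [AddCommGroup A] [Fintype A] in
/-- `coef (0,t) (δ s) = −1` iff `s = t`. [folklore] -/
theorem coef_zero_delta (t s : A) : coef A (0, t) (δ A s) = if s = t then -1 else 1 := by
  simp only [coef, delta_apply]
  by_cases h : s = t
  · subst h; simp
  · simp [h, Ne.symm h]

omit [AddCommGroup A] [Fintype A] in
/-- `coef (0,t) (1 + δ s) = 1` iff `s = t`. [folklore] -/
theorem coef_zero_one_add_delta (t s : A) : coef A (0, t) (1 + δ A s) = if s = t then 1 else -1 := by
  have h11 : (1 : ZMod 2) + 1 = 0 := by decide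
  simp only [coef, Pi.add_apply, Pi.one_apply, delta_apply]
  by_cases h : s = t
  · subst h; simp [h11]
  · simp [h, Ne.symm h]

omit [AddCommGroup A] [DecidableEq A] in
/-- `cwt 0 = 0`. [folklore] -/
theorem cwt_zero' : cwt A (0 : Ty A) = 0 := by unfold cwt; rw [wt_zero]; simp

omit [AddCommGroup A] [DecidableEq A] in
/-- `cwt 1 = 0`. [folklore] -/
theorem cwt_one' : cwt A (1 : Ty A) = 0 := by
  have hw1 : wt A (1 : Ty A) = Fintype.card A := by
    have := wt_add_one A (0 : Ty A); rw [zero_add, wt_zero] at this; omega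
  unfold cwt; rw [hw1]
  by_cases h : Fintype.card A ≤ Fintype.card A / 2
  · have h0 : Fintype.card A = 0 := by omega
    rw [if_pos h, h0]; simp
  · rw [if_neg h]; simp

omit [AddCommGroup A] in
/-- `cwt (δ s) = 1` (`|A| ≥ 3`). [folklore] -/
theorem cwt_delta' (h3 : 3 ≤ Fintype.card A) (s : A) : cwt A (δ A s) = 1 := by
  unfold cwt; rw [wt_delta, if_pos (by omega)]; simp

omit [AddCommGroup A] in
/-- `cwt (1 + δ s) = −1` (`|A| ≥ 3`). [folklore] -/
theorem cwt_one_add_delta' (h3 : 3 ≤ Fintype.card A) (s : A) : cwt A (1 + δ A s) = -1 := by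
  unfold cwt
  rw [add_comm, wt_add_one, wt_delta, if_neg (by omega), Nat.cast_sub (by omega)]; ring

omit [AddCommGroup A] in
/-- A sum with one exceptional coefficient. [folklore] -/
theorem sum_ite_mul (t : A) (f : A → ℤ) (a b : ℤ) :
    ∑ t' : A, (if t' = t then a else b) * f t' = b * ∑ t' : A, f t' + (a - b) * f t := by
  have hterm : ∀ t' : A, (if t' = t then a else b) * f t' = b * f t' + (if t' = t then (a - b) * f t' else 0) := by
    intro t'
    by_cases h : t' = t
    · rw [if_pos h, if_pos h]; ring
    · rw [if_neg h, if_neg h]; ring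
  rw [Finset.sum_congr rfl fun t' _ => hterm t', Finset.sum_add_distrib, ← Finset.mul_sum, Finset.sum_ite_eq' univ t,
    if_pos (Finset.mem_univ _)]

section Data

variable {A}
variable (h3 : 3 ≤ Fintype.card A) {r : Ty₂ A → ℤ} (hp : ∀ Ψ, r Ψ ≠ 0 → pot A Ψ ≤ 1) (hl : ∀ Ψ, r Ψ ≠ 0 → (wt A Ψ.1 ≤ Fintype.card A / 2))
include h3 hp hl

omit [AddCommGroup A] [DecidableEq A] h3 in
/-- Support transfer to a weighted copy of `r`. [folklore] -/
theorem weighted_normal (w : Ty₂ A → ℤ) : ∀ Ψ, w Ψ * r Ψ ≠ 0 → pot A Ψ ≤ 1 ∧ (wt A Ψ.1 ≤ Fintype.card A / 2) :=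
  fun Ψ h => ⟨hp Ψ (fun hz => h (by rw [hz, mul_zero])), hl Ψ (fun hz => h (by rw [hz, mul_zero]))⟩

omit [AddCommGroup A] in
/-- **The form of `(0,t)` on the `1`-marginal of a normal residual vector.** [folklore] -/
theorem form₁_eq (t : A) : coef A (0, t) ⬝ᵥ marg₁ A r =
    r (0, 0) - r (0, 1) + ∑ t' : A, r (0, δ A t') - ∑ t' : A, r (0, 1 + δ A t') + ∑ s : A, r (δ A s, 0) -
      ∑ s : A, r (δ A s, 1) - 2 * r (0, δ A t) + 2 * r (0, 1 + δ A t) := by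
  rw [coef_dotProduct_marg₁, sum_eq_of_normal A h3 _ (weighted_normal hp hl _)]
  simp only [coef_zero_zero, coef_zero_one, coef_zero_delta, coef_zero_one_add_delta, one_mul, neg_one_mul,
    Finset.sum_neg_distrib, sum_ite_mul]
  ring

omit [AddCommGroup A] in
/-- **The form of `(0,t)` on the `0`-marginal of a normal residual vector.** [folklore] -/
theorem form₀_eq (t : A) : coef A (0, t) ⬝ᵥ marg₀ A r =
    r (0, 0) + r (0, 1) + ∑ t' : A, r (0, δ A t') + ∑ t' : A, r (0, 1 + δ A t') + ∑ s : A, r (δ A s, 0) +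
      ∑ s : A, r (δ A s, 1) - 2 * (r (δ A t, 0) + r (δ A t, 1)) := by
  rw [coef_dotProduct_marg₀, sum_eq_of_normal A h3 _ (weighted_normal hp hl _)]
  simp only [coef_zero_zero, coef_zero_delta, one_mul, sum_ite_mul]
  ring

omit [AddCommGroup A] in
/-- **`C₁` of a normal residual vector is `P − Q`.** [folklore] -/
theorem C₁_normal : C₁ A r = ∑ t : A, r (0, δ A t) - ∑ t : A, r (0, 1 + δ A t) := by
  rw [C₁_eq_sum, sum_eq_of_normal A h3 _ (weighted_normal hp hl _)]
  simp only [cwt_zero', cwt_one', cwt_delta' A h3, cwt_one_add_delta' A h3, zero_mul, one_mul, neg_one_mul,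
    Finset.sum_neg_distrib, Finset.sum_const_zero]
  ring

omit [AddCommGroup A] in
/-- **`C₀` of a normal residual vector is `Y + Z`.** [folklore] -/
theorem C₀_normal : C₀ A r = ∑ s : A, r (δ A s, 0) + ∑ s : A, r (δ A s, 1) := by
  rw [C₀_eq_sum, sum_eq_of_normal A h3 _ (weighted_normal hp hl _)]
  simp only [cwt_zero', cwt_delta' A h3, zero_mul, one_mul, Finset.sum_const_zero, zero_add]

/-! ## §3 The key lemma -/

omit [AddCommGroup A] in
/-- **`|A|` divides `C₁` of a normal residual Hodge vector** (the differences `p_t − q_t` are constant). [folklore] -/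
theorem card_dvd_C₁ (hr : r ∈ hodge₂ A) : (Fintype.card A : ℤ) ∣ C₁ A r := by
  haveI : Nonempty A := Fintype.card_pos_iff.mp (by omega)
  obtain ⟨t₀⟩ := (inferInstance : Nonempty A)
  have hf : ∀ t, coef A (0, t) ⬝ᵥ marg₁ A r = 0 := fun t => ((mem_hodge₂_iff A r).mp hr).2 (0, t)
  have hconst : ∀ t, r (0, δ A t) - r (0, 1 + δ A t) = r (0, δ A t₀) - r (0, 1 + δ A t₀) := by
    intro t
    have h1 := hf t; have h2 := hf t₀
    rw [form₁_eq h3 hp hl] at h1 h2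
    linarith
  refine ⟨r (0, δ A t₀) - r (0, 1 + δ A t₀), ?_⟩
  rw [C₁_normal h3 hp hl, ← Finset.sum_sub_distrib, Finset.sum_congr rfl fun t _ => hconst t, Finset.sum_const, Finset.card_univ,
    nsmul_eq_mul]

omit [AddCommGroup A] in
/-- **`|A|` divides `C₀` of a normal residual Hodge vector** (the sums `y_s + z_s` are constant). [folklore] -/
theorem card_dvd_C₀ (hr : r ∈ hodge₂ A) : (Fintype.card A : ℤ) ∣ C₀ A r := by
  haveI : Nonempty A := Fintype.card_pos_iff.mp (by omega)
  obtain ⟨t₀⟩ := (inferInstance : Nonempty A)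
  have hf : ∀ t, coef A (0, t) ⬝ᵥ marg₀ A r = 0 := fun t => ((mem_hodge₂_iff A r).mp hr).1 (0, t)
  have hconst : ∀ t, r (δ A t, 0) + r (δ A t, 1) = r (δ A t₀, 0) + r (δ A t₀, 1) := by
    intro t
    have h1 := hf t; have h2 := hf t₀
    rw [form₀_eq h3 hp hl] at h1 h2
    linarith
  refine ⟨r (δ A t₀, 0) + r (δ A t₀, 1), ?_⟩
  rw [C₀_normal h3 hp hl, ← Finset.sum_add_distrib, Finset.sum_congr rfl fun t _ => hconst t, Finset.sum_const, Finset.card_univ,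
    nsmul_eq_mul]

/-- **THE KEY LEMMA.**  A Hodge vector supported on the normal residual labels on which all `U_s`, `U'_s`, `C₀`, `C₁` vanish is zero.
[folklore] -/
theorem eq_zero_of_normal (hr : r ∈ hodge₂ A) (hU : ∀ s, U A s r = 0) (hU' : ∀ s, U' A s r = 0) (hC₀ : C₀ A r = 0)
    (hC₁ : C₁ A r = 0) : r = 0 := by
  haveI : Nonempty A := Fintype.card_pos_iff.mp (by omega)
  have hm : (0 : ℤ) < Fintype.card A := by exact_mod_cast (show 0 < Fintype.card A by omega)
  -- the coefficients read by `U`, `U'`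
  have hq : ∀ s, r (0, 1 + δ A s) = 0 := fun s => by rw [← U_residual A h3 s hp hl]; exact hU s
  have hz : ∀ s, r (δ A s, 1) = 0 := fun s => by have := U'_residual A h3 s hp hl; rw [hU' s] at this; linarith
  have hQ : ∑ t : A, r (0, 1 + δ A t) = 0 := Finset.sum_eq_zero fun t _ => hq t
  have hZ : ∑ s : A, r (δ A s, 1) = 0 := Finset.sum_eq_zero fun s _ => hz s
  -- `C₁ = P − Q = 0`, `C₀ = Y + Z = 0`
  have hP : ∑ t : A, r (0, δ A t) = 0 := by have := C₁_normal h3 hp hl (r := r); rw [hC₁, hQ] at this; linarith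
  have hY : ∑ s : A, r (δ A s, 0) = 0 := by have := C₀_normal h3 hp hl (r := r); rw [hC₀, hZ] at this; linarith
  -- the forms
  have hf₁ : ∀ t, coef A (0, t) ⬝ᵥ marg₁ A r = 0 := fun t => ((mem_hodge₂_iff A r).mp hr).2 (0, t)
  have hf₀ : ∀ t, coef A (0, t) ⬝ᵥ marg₀ A r = 0 := fun t => ((mem_hodge₂_iff A r).mp hr).1 (0, t)
  have hp' : ∀ t, 2 * r (0, δ A t) = r (0, 0) - r (0, 1) := by
    intro t; have h1 := hf₁ t
    rw [form₁_eq h3 hp hl, hP, hQ, hY, hZ, hq t] at h1; linarith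
  have hy' : ∀ t, 2 * r (δ A t, 0) = r (0, 0) + r (0, 1) := by
    intro t; have h1 := hf₀ t
    rw [form₀_eq h3 hp hl, hP, hQ, hY, hZ, hz t] at h1; linarith
  -- summing over `t`
  have hsumP : (Fintype.card A : ℤ) * (r (0, 0) - r (0, 1)) = 0 := by
    have : ∑ t : A, 2 * r (0, δ A t) = ∑ t : A, (r (0, 0) - r (0, 1)) := Finset.sum_congr rfl fun t _ => hp' t
    rw [← Finset.mul_sum, hP, mul_zero, Finset.sum_const, Finset.card_univ, nsmul_eq_mul] at this
    linarith
  have hsumY : (Fintype.card A : ℤ) * (r (0, 0) + r (0, 1)) = 0 := by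
    have : ∑ t : A, 2 * r (δ A t, 0) = ∑ t : A, (r (0, 0) + r (0, 1)) := Finset.sum_congr rfl fun t _ => hy' t
    rw [← Finset.mul_sum, hY, mul_zero, Finset.sum_const, Finset.card_univ, nsmul_eq_mul] at this
    linarith
  have hd : r (0, 0) - r (0, 1) = 0 := by
    rcases mul_eq_zero.mp hsumP with h | h
    · exact absurd h (ne_of_gt hm)
    · exact h
  have hs : r (0, 0) + r (0, 1) = 0 := by
    rcases mul_eq_zero.mp hsumY with h | h
    · exact absurd h (ne_of_gt hm)
    · exact h
  have hx0 : r (0, 0) = 0 := by linarith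
  have hx1 : r (0, 1) = 0 := by linarith
  have hpt : ∀ t, r (0, δ A t) = 0 := fun t => by have := hp' t; rw [hd] at this; linarith
  have hyt : ∀ t, r (δ A t, 0) = 0 := fun t => by have := hy' t; rw [hs] at this; linarith
  -- every coefficient vanishes
  funext Ψ
  by_contra hne
  rcases normal_cases A (hp Ψ hne) (hl Ψ hne) with ⟨ha, hb⟩ | ⟨s, ha, hb⟩
  · obtain ⟨a, b⟩ := Ψ
    simp only at ha hb; subst ha
    rcases hb with rfl | rfl | ⟨t, rfl | rfl⟩
    · exact hne hx0
    · exact hne hx1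
    · exact hne (hpt t)
    · exact hne (hq t)
  · obtain ⟨a, b⟩ := Ψ
    simp only at ha hb; subst ha
    rcases hb with rfl | rfl
    · exact hne (hyt s)
    · exact hne (hz s)

end Data

end Summit.HodgeConjecture.CorCM.Census.DicyclicTwist
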